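import Summits.Ventures.PercRepro.RankDistBook

/-!
# PercRepro — THE RANK IN THE BOOK MATROID from the pattern of a set (p9, gen 23)

`B_k = book f hf` (`RankDistBook`). For `A ⊆ range f` write `[e₀ ∈ A]`, `hit(A)`, `full(A)` for its pattern. Deleting the
`b_i`-element of each pair of a set `J ⊆ full(A)` leaves a BASIS of `A` as soon as what is left is independent and
`J = ∅` or what is left has count exactly one (`rk_book_add_card`: `ρ(A) + |J| = |A|`); choosing `J = full(A)` when
`e₀ ∈ A`, `J = ∅` when `full(A) = ∅`, and `J = full(A) ∖ {i₀}` otherwise gives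
**`rk_book`: `ρ(A) = #hit(A) + min(1, [e₀ ∈ A] + #full(A))`** — the page vertex of a hit pair is attached, and the
spine vertices `0, 1` are joined iff `e₀ ∈ A` or some pair is full. Nothing here moves any window of the crux.
-/

namespace PercRepro.RankDist

open Set Finset _root_.Matroid PercRepro.ThmH

variable {α : Type} {k : ℕ} (f : Option (Fin k × Bool) → α)

/-! ## The rank from the pattern -/

/-- Deleting the `true`-element of each pair of `J ⊆ full(A)` leaves a basis of `A` when what is left is
independent and `J` is empty or what is left has count exactly one. -/
lemma rk_book_add_card (hf : Function.Injective f) {A : Set α} (hA : A ⊆ Set.range f) {J : Finset (Fin k)}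
    (hJ : J ⊆ bookFull f A) (h1 : bookSp f A + (bookFull f A \ J).card ≤ 1)
    (h3 : J.Nonempty → 1 ≤ bookSp f A + (bookFull f A \ J).card) :
    rk (book f hf) A + J.card = A.ncard := by
  classical
  set R : Set α := ((J.image (fun i => f (some (i, true))) : Finset α) : Set α) with hR
  have hfinA : A.Finite := (Set.finite_range f).subset hA
  have hRA : R ⊆ A := by
    intro x hx
    rw [hR, Finset.coe_image] at hx
    obtain ⟨i, hi, rfl⟩ := hx
    exact ((mem_bookFull f).1 (hJ (Finset.mem_coe.1 hi))).2
  have hRcard : R.ncard = J.card := by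
    rw [hR, Set.ncard_coe_finset, Finset.card_image_of_injective]
    intro i j hij
    have := hf hij
    simpa using this
  have hnoneR : f none ∉ R := by
    intro hx
    rw [hR, Finset.mem_coe, Finset.mem_image] at hx
    obtain ⟨i, -, hi⟩ := hx
    have := hf hi
    simp at this
  have hfalseR : ∀ i : Fin k, f (some (i, false)) ∉ R := by
    intro i hx
    rw [hR, Finset.mem_coe, Finset.mem_image] at hx
    obtain ⟨j, -, hj⟩ := hx
    have := hf hj
    simp at this
  have htrueR : ∀ i : Fin k, f (some (i, true)) ∈ R ↔ i ∈ J := by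
    intro i
    rw [hR, Finset.mem_coe, Finset.mem_image]
    constructor
    · rintro ⟨j, hj, hji⟩
      have := hf hji
      simp only [Option.some.injEq, Prod.mk.injEq, and_true] at this
      rw [← this]; exact hj
    · intro hi; exact ⟨i, hi, rfl⟩
  -- the pattern of `A \ R`
  have hsp : bookSp f (A \ R) = bookSp f A := by
    unfold bookSp
    simp only [Set.mem_sdiff, hnoneR, not_false_eq_true, and_true]
  have hfull : bookFull f (A \ R) = bookFull f A \ J := by
    ext i
    simp only [mem_bookFull, Set.mem_sdiff, Finset.mem_sdiff, hfalseR, not_false_eq_true, and_true, htrueR]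
    tauto
  have hI : (book f hf).Indep (A \ R) := by
    rw [book_indep_iff]
    refine ⟨Set.sdiff_subset.trans hA, ?_⟩
    rw [hsp, hfull]; exact h1
  have hbasis : (book f hf).IsBasis (A \ R) A := by
    refine hI.isBasis_of_forall_insert Set.sdiff_subset ?_
    intro e he
    rw [Set.mem_sdiff, Set.mem_sdiff, not_and, not_not] at he
    have heR : e ∈ R := he.2 he.1
    rw [hR, Finset.mem_coe, Finset.mem_image] at heR
    obtain ⟨i, hiJ, rfl⟩ := heR
    refine ⟨?_, Set.insert_subset (hA he.1) (Set.sdiff_subset.trans hA)⟩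
    rw [book_indep_iff]
    rintro ⟨-, hcount⟩
    have hne : f (some (i, true)) ≠ f none := fun h => by simpa using hf h
    rw [bookSp_insert_of_ne f hne, hsp] at hcount
    -- the pair `i` is full after the insertion, and `full(A) \ J` is untouched
    have hiF : i ∈ bookFull f (insert (f (some (i, true))) (A \ R)) := by
      rw [mem_bookFull]
      refine ⟨Or.inr ⟨((mem_bookFull f).1 (hJ hiJ)).1, hfalseR i⟩, Set.mem_insert _ _⟩
    have hsub : insert i (bookFull f A \ J) ⊆ bookFull f (insert (f (some (i, true))) (A \ R)) := by
      intro j hj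
      rw [Finset.mem_insert] at hj
      rcases hj with rfl | hj
      · exact hiF
      · rw [← hfull] at hj
        exact bookFull_subset_insert f _ _ hj
    have hiJ' : i ∉ bookFull f A \ J := fun h => (Finset.mem_sdiff.1 h).2 hiJ
    have := Finset.card_le_card hsub
    rw [Finset.card_insert_of_notMem hiJ'] at this
    have := h3 ⟨i, hiJ⟩
    omega
  have hrk : (book f hf).eRk A = ((A \ R).ncard : ℕ∞) := by
    rw [← hbasis.encard_eq_eRk, (hfinA.subset Set.sdiff_subset).cast_ncard_eq]
  have hrk' : rk (book f hf) A = (A \ R).ncard := by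
    rw [rk_eq_iff (book f hf) (by rw [book_ground]; exact hA)]
    exact hrk
  rw [hrk', Set.ncard_sdiff' hRA hfinA, hRcard]
  have := Set.ncard_le_ncard hRA hfinA
  omega

/-- **The rank in the book**: `ρ(A) = #hit(A) + min(1, [e₀ ∈ A] + #full(A))`. -/
theorem rk_book (hf : Function.Injective f) {A : Set α} (hA : A ⊆ Set.range f) :
    rk (book f hf) A = (bookHit f A).card + min 1 (bookSp f A + (bookFull f A).card) := by
  classical
  have hsize := ncard_eq_pattern f hf hA
  have hsp := bookSp_le_one f A
  rcases Nat.eq_zero_or_pos (bookSp f A) with h0 | h1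
  · rcases Finset.eq_empty_or_nonempty (bookFull f A) with hF | ⟨i₀, hi₀⟩
    · -- `J = ∅`
      have := rk_book_add_card f hf hA (J := ∅) (Finset.empty_subset _)
        (by rw [Finset.sdiff_empty, hF, Finset.card_empty]; omega)
        (fun h => absurd h Finset.not_nonempty_empty)
      rw [Finset.card_empty] at this
      rw [hF, Finset.card_empty] at hsize ⊢
      omega
    · -- `J = full(A) ∖ {i₀}`
      have hsd : bookFull f A \ (bookFull f A).erase i₀ = {i₀} := by
        ext j
        simp only [Finset.mem_sdiff, Finset.mem_erase, Finset.mem_singleton, not_and]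
        constructor
        · rintro ⟨hj, h⟩
          by_contra hne
          exact h hne hj
        · rintro rfl
          exact ⟨hi₀, fun h _ => h rfl⟩
      have := rk_book_add_card f hf hA (J := (bookFull f A).erase i₀) (Finset.erase_subset _ _)
        (by rw [hsd, Finset.card_singleton]; omega)
        (fun _ => by rw [hsd, Finset.card_singleton]; omega)
      rw [Finset.card_erase_of_mem hi₀] at this
      have hpos := Finset.card_pos.2 ⟨i₀, hi₀⟩
      omega
  · -- `J = full(A)`
    have := rk_book_add_card f hf hA (J := bookFull f A) (Finset.Subset.refl _)
      (by rw [Finset.sdiff_self, Finset.card_empty]; omega)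
      (fun _ => by rw [Finset.sdiff_self, Finset.card_empty]; omega)
    omega

end PercRepro.RankDist
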